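import Mathlib
import Summits.Ventures.PercRepro2.Defs
import Summits.Ventures.PercRepro2.Graph
import Summits.Ventures.PercRepro2.HullDefs
import Summits.Ventures.PercRepro2.LocRows
import Summits.Ventures.PercRepro2.SwRow
import Summits.Ventures.PercRepro2.SwGlue
import Summits.Ventures.PercRepro2.SwAllRow
import Summits.Ventures.PercRepro2.SwAllBlocks
import Summits.Ventures.PercRepro2.RigidOneSided

/-!
# Row 2′SW-ALL across a cut separating `l` from `{h, o}` (blind cell PercRepro2, night-4 g5,
2026-08-24; proofs/NIGHT4-BRIDGE.md §11, placement `l ∣ {h, o}`)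

`l` on the first side, `h, o` on the second, cut vertex `c`.  On `Q(G)` the red cluster of `l`
contains `c` (it contains `o`), hence `c ∉ C_R(h)`: the red cluster of `h` lives on the `h`-side.  Two
classes by the status of `c` in the blue cluster of `l`: in the core the `h`-side configuration is
in `Q(G₂; c, h, o)` (apply 2′SW-ALL(G₂)), on the red side only it is in
`{o ∈ C_R(c), h ∉ C_R(c)}` (apply the RIGID one-sided permutation `RigidOS.exists_rigidOneSided`).
The first side is kept; both permutations turn every red edge inside `C_R(h)` blue.
`swAll_glue_sep_l`: 2′SW-ALL(G₂; c, h, o) ⟹ 2′SW-ALL(G; l, h, o) — the rigid form of night-4 g4's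
`sw_glue_sep_l`.
-/

namespace Summit.Ventures.PercRepro2

namespace Glue

open Hull LocRows RigidOS

open scoped Classical

variable {V : Type*} {E₁ E₂ : Type*}
variable {ends₁ : E₁ → Sym2 V} {ends₂ : E₂ → Sym2 V} {c : V} {V₁ V₂ : Set V}

variable [Fintype E₁] [Fintype E₂] [DecidableEq E₁] [DecidableEq E₂]

/-- **2′SW-ALL across a cut separating `l` from `{h, o}`**: 2′SW-ALL on the `{h, o}`-side with the
cut vertex as the root gives 2′SW-ALL on the glued graph. -/
theorem swAll_glue_sep_l {l h o : V} (hg : IsGluing ends₁ ends₂ c V₁ V₂) (hl : l ∈ V₁) (hh : h ∈ V₂)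
    (hhc : h ≠ c) (ho : o ∈ V₂) (hoc : o ≠ c) (h₂ : SwAll ends₂ c h o) :
    SwAll (glue ends₁ ends₂) l h o := by
  obtain ⟨φ, hφ, hmemφ⟩ := h₂
  obtain ⟨χ, hχ, hmemχ⟩ := exists_rigidOneSided ends₂ c h o
  -- membership in `Q(G)`
  have key : ∀ ζ : Config (E₁ ⊕ E₂),
      ζ ∈ tgtU (glue ends₁ ends₂) l h {S : Set V | o ∈ S} ↔
        (¬ (c ∈ cluster ends₁ (ζ ∘ Sum.inl) l ∧ h ∈ cluster ends₂ (ζ ∘ Sum.inr) c) ∧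
          ¬ (c ∈ cluster ends₁ (blue (ζ ∘ Sum.inl)) l ∧ h ∈ cluster ends₂ (blue (ζ ∘ Sum.inr)) c)) ∧
          (c ∈ cluster ends₁ (ζ ∘ Sum.inl) l ∧ o ∈ cluster ends₂ (ζ ∘ Sum.inr) c) ∧
          ¬ (c ∈ cluster ends₁ (blue (ζ ∘ Sum.inl)) l ∧ o ∈ cluster ends₂ (blue (ζ ∘ Sum.inr)) c) := by
    intro ζ
    rw [mem_tgtU_glue_iff, mem_cluster_glue_iff_across hg hl hh hhc,
      mem_cluster_glue_iff_across hg hl hh hhc, mem_cluster_glue_iff_across hg hl ho hoc,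
      mem_cluster_glue_iff_across hg hl ho hoc, blue_comp_inl, blue_comp_inr]
  -- membership in `Q(G₂; c, h, o)`
  have key₂ : ∀ ζ₂ : Config E₂,
      ζ₂ ∈ tgtU ends₂ c h {S : Set V | o ∈ S} ↔
        (h ∉ cluster ends₂ ζ₂ c ∧ h ∉ cluster ends₂ (blue ζ₂) c) ∧
          o ∈ cluster ends₂ ζ₂ c ∧ o ∉ cluster ends₂ (blue ζ₂) c := by
    intro ζ₂
    simp only [tgtU, Finset.mem_filter, Finset.mem_univ, true_and, mem_hull_iff, Set.mem_setOf_eq,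
      not_or]
  -- the core class lies in `Q(G₂; c, h, o)`, the red class in the one-sided class
  have pK : ∀ x : {ζ // ζ ∈ tgtU (glue ends₁ ends₂) l h {S : Set V | o ∈ S}},
      c ∈ cluster ends₁ (blue (x.1 ∘ Sum.inl)) l →
        x.1 ∘ Sum.inr ∈ tgtU ends₂ c h {S : Set V | o ∈ S} := by
    intro x hB
    obtain ⟨⟨h1, h2⟩, ⟨h3, h4⟩, h5⟩ := (key x.1).1 x.2
    exact (key₂ _).2 ⟨⟨fun h' => h1 ⟨h3, h'⟩, fun h' => h2 ⟨hB, h'⟩⟩, h4, fun h' => h5 ⟨hB, h'⟩⟩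
  have pR : ∀ x : {ζ // ζ ∈ tgtU (glue ends₁ ends₂) l h {S : Set V | o ∈ S}},
      x.1 ∘ Sum.inr ∈ osClass ends₂ c h o := by
    intro x
    obtain ⟨⟨h1, _⟩, ⟨h3, h4⟩, _⟩ := (key x.1).1 x.2
    simp only [osClass, Finset.mem_filter, Finset.mem_univ, true_and]
    exact ⟨h4, fun h' => h1 ⟨h3, h'⟩⟩
  -- on `Q(G)` the red cluster of `h` lives on the `h`-side
  have hT : ∀ ζ : Config (E₁ ⊕ E₂), ζ ∈ tgtU (glue ends₁ ends₂) l h {S : Set V | o ∈ S} →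
      cluster (glue ends₁ ends₂) ζ h = cluster ends₂ (ζ ∘ Sum.inr) h := by
    intro ζ hζ
    obtain ⟨⟨h1, _⟩, ⟨h3, _⟩, _⟩ := (key ζ).1 hζ
    rw [cluster_glue_eq₂ hg hh]
    ext u
    simp only [Set.mem_union, Set.mem_setOf_eq]
    constructor
    · rintro (hu | ⟨hc, _⟩)
      · exact hu
      · exact absurd ⟨h3, mem_cluster_comm.1 hc⟩ h1
    · exact Or.inl
  -- the edges inside the red cluster of `h`: none on the first side, the second-side ones inside
  -- the second-side cluster
  have hinl : ∀ x : {ζ // ζ ∈ tgtU (glue ends₁ ends₂) l h {S : Set V | o ∈ S}}, ∀ e₁ : E₁,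
      Sum.inl e₁ ∈ within (glue ends₁ ends₂) (cluster (glue ends₁ ends₂) x.1 h) → False := by
    intro x e₁ he
    obtain ⟨⟨h1, _⟩, ⟨h3, _⟩, _⟩ := (key x.1).1 x.2
    obtain ⟨a, ⟨ha, haV₁⟩, _, _, _⟩ := mem_within_inl_glue hg he
    rw [hT x.1 x.2] at ha
    have haV₂ : a ∈ V₂ := cluster_subset_of_mem₂ hg hh ha
    rw [hg.inter a haV₁ haV₂] at ha
    exact h1 ⟨h3, mem_cluster_comm.1 ha⟩
  have hinr : ∀ x : {ζ // ζ ∈ tgtU (glue ends₁ ends₂) l h {S : Set V | o ∈ S}}, ∀ e₂ : E₂,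
      Sum.inr e₂ ∈ within (glue ends₁ ends₂) (cluster (glue ends₁ ends₂) x.1 h) →
        e₂ ∈ within ends₂ (cluster ends₂ (x.1 ∘ Sum.inr) h) := by
    intro x e₂ he
    obtain ⟨a, ⟨ha, _⟩, b, ⟨hb, _⟩, hends⟩ := mem_within_inr_glue hg he
    rw [hT x.1 x.2] at ha hb
    exact ⟨a, ha, b, hb, hends⟩
  refine ⟨fun x => if hB : c ∈ cluster ends₁ (blue (x.1 ∘ Sum.inl)) l
      then pair (x.1 ∘ Sum.inl) (φ ⟨x.1 ∘ Sum.inr, pK x hB⟩)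
      else pair (x.1 ∘ Sum.inl) (χ ⟨x.1 ∘ Sum.inr, pR x⟩), ?_, ?_⟩
  · -- injective: the first side is kept, so the class is kept
    intro x y hxy
    simp only at hxy
    have h1 := congrArg (fun ζ => ζ ∘ Sum.inl) hxy
    by_cases hx : c ∈ cluster ends₁ (blue (x.1 ∘ Sum.inl)) l <;>
      by_cases hy : c ∈ cluster ends₁ (blue (y.1 ∘ Sum.inl)) l
    · rw [dif_pos hx, dif_pos hy] at hxy h1
      simp only [pair_inl] at h1
      have h2 := congrArg (fun ζ => ζ ∘ Sum.inr) hxy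
      simp only [pair_inr] at h2
      have h2' : x.1 ∘ Sum.inr = y.1 ∘ Sum.inr := congrArg Subtype.val (hφ h2)
      apply Subtype.ext
      rw [← pair_comp x.1, ← pair_comp y.1, h1, h2']
    · rw [dif_pos hx, dif_neg hy] at h1
      simp only [pair_inl] at h1
      rw [h1] at hx
      exact absurd hx hy
    · rw [dif_neg hx, dif_pos hy] at h1
      simp only [pair_inl] at h1
      rw [h1] at hx
      exact absurd hy hx
    · rw [dif_neg hx, dif_neg hy] at hxy h1
      simp only [pair_inl] at h1
      have h2 := congrArg (fun ζ => ζ ∘ Sum.inr) hxy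
      simp only [pair_inr] at h2
      have h2' : x.1 ∘ Sum.inr = y.1 ∘ Sum.inr := congrArg Subtype.val (hχ h2)
      apply Subtype.ext
      rw [← pair_comp x.1, ← pair_comp y.1, h1, h2']
  · intro x
    obtain ⟨⟨h1, h2⟩, ⟨h3, h4⟩, h5⟩ := (key x.1).1 x.2
    by_cases hB : c ∈ cluster ends₁ (blue (x.1 ∘ Sum.inl)) l
    · -- the core class: 2′SW-ALL on the `h`-side
      simp only [dif_pos hB]
      obtain ⟨ht, hflip⟩ := hmemφ ⟨x.1 ∘ Sum.inr, pK x hB⟩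
      obtain ⟨⟨h1', h2'⟩, h3', h4'⟩ := (key₂ _).1 ht
      refine ⟨(key _).2 ?_, ?_⟩
      · rw [pair_inl, pair_inr]
        exact ⟨⟨fun h' => h1' h'.2, fun h' => h2' h'.2⟩, ⟨h3, h3'⟩, fun h' => h4' h'.2⟩
      · intro e he hred
        rcases e with e₁ | e₂
        · exact absurd he (hinl x e₁)
        · show φ ⟨x.1 ∘ Sum.inr, pK x hB⟩ e₂ = false
          exact hflip e₂ (hinr x e₂ he) hred
    · -- the red class: the rigid one-sided permutation
      simp only [dif_neg hB]
      obtain ⟨ht, hflip⟩ := hmemχ ⟨x.1 ∘ Sum.inr, pR x⟩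
      simp only [osClass, Finset.mem_filter, Finset.mem_univ, true_and] at ht
      refine ⟨(key _).2 ?_, ?_⟩
      · rw [pair_inl, pair_inr]
        exact ⟨⟨fun h' => ht.2 h'.2, fun h' => hB h'.1⟩, ⟨h3, ht.1⟩, fun h' => hB h'.1⟩
      · intro e he hred
        rcases e with e₁ | e₂
        · exact absurd he (hinl x e₁)
        · show χ ⟨x.1 ∘ Sum.inr, pR x⟩ e₂ = false
          exact hflip e₂ (hinr x e₂ he) hred

end Glue

end Summit.Ventures.PercRepro2
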